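import Summits.AtomisticToContinuum.Crystallization.Theorems.ThreeConeCertificateSlackRigidityPricedFloorsSelection
import HarnessLib

/-!
# `SlackRigidity` (stmt-AtomisticToContinuum-11960), line `priced-floors-palm-exactification`:
# the cluster-selection engine with exported cube and boundary-fraction control

Stub `stub_clusterSelectionBdry` of lead c19's skeleton: the selection engine
`SlackRigidityPricedFloorsSelection.exists_deepBadCluster` (p138907; generic form of
`SlackRigidityLawSelection.exists_badCluster`, p131361) EXTENDED.  For a point-stationary probability
law `P`, a.s. rooted `δ`-hard-core and minimising, and a measurable event `G` with `P(Gᶜ) ≠ 0`, there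
is `b > 0` (`= P(Gᶜ)/4`) such that for all `R, r`, `κ > 0`, `η > 0`, `M` there are a rooted
`δ`-separated sample `S ∋ 0`, a mesh `L ≥ M`, a phase `v` and the cube cluster `T = S ∩ rootCell L v`
with `#T ≥ M`, `𝓔(T) ≤ #T e* + η #T`, at least `b #T` points `y ∈ T` that are `R`-deep
(`S ∩ B̄(y, R) ⊆ T`) and bad (`θ_y (count|S) ∉ G`), and AT MOST `κ #T` points that are not `r`-deep.

Proof: `exists_badCluster` with a THIRD functional.  Besides the bad functional
`f_B = 1[μ ∉ G] 1[v deep_R]` (`E[∫ cellAvg f_B] = P(Gᶜ) vol(deep_R)`, `SlackRigidityLawBad`) and the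
energy functional `f_E` (`E[∫ f_E] ≤ V ofReal (e* + C_δ) + E[err_L]/12`, `SlackRigidityLawEnergy`),
the BOUNDARY functional `f_∂ = 1[v ∉ deep_r]` has `E[∫ f_∂] = vol([0,1)³ ∖ deep_r) → 0`
(`tendsto_volume_nondeep`) and cell average `≥` the fraction of points of the cluster that are not
`r`-deep (`card_notDeep_div_le`: an `r`-deep phase puts the closed `r`-ball inside the cell).  If no
`(S, T, L, v)` qualified, then pointwise `cellAvg f_B + c/τ ≤ b + cellAvg (f_E/τ + f_∂/κ)`
(`pointwise_bound`, `τ = min η τ_M`); integrating (cell-averaging identity for the measurable periodic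
functional `f_E/τ + f_∂/κ`, `SlackRigidityLawCellAverage`) at a mesh with `E[err_L]/(12τ)`,
`vol(∖ deep_r)/κ ≤ β V/8` gives `β V/2 + e < β V/4 + β V/8 + β V/8 + e`, absurd.  All `[folklore]`.
-/

noncomputable section

open MeasureTheory Filter Set
open scoped ENNReal BigOperators Topology

namespace Summit.AtomisticToContinuum.Crystallization.Theorems.SlackRigidityPricedFloorsSelectionBdry

open Literature.Probability.Process
open Literature.MathematicalPhysics.StatisticalMechanics (lennardJones interactionEnergy groundStateEnergy
  rootEnergy)
open Summit.AtomisticToContinuum.Crystallization.Theorems.PalmUnimodularRigidityMinimiserShells.EnergyFloor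
open Summit.AtomisticToContinuum.Crystallization.Theorems.MinimiserShells.Negative.LoadBearing (eStar)
open Summit.AtomisticToContinuum.Crystallization.Theorems.SlackRigidityPricedFloors
open Summit.AtomisticToContinuum.Crystallization.Theorems.SlackRigidityLawCellAverage
  (lintegral_phase_eq_cellAverage)
open Summit.AtomisticToContinuum.Crystallization.Theorems.SlackRigidityLawEnergy
open Summit.AtomisticToContinuum.Crystallization.Theorems.SlackRigidityLawBad
open Summit.AtomisticToContinuum.Crystallization.Theorems.SlackRigidityLawSelection
  (exists_pos_lt_excessRate)
open Summit.AtomisticToContinuum.Crystallization.Theorems.SlackRigidityPricedFloorsSelection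
  (cellAvg_deepBad_le)

variable {R r δ L : ℝ} {G : Set (Measure E3)} {S : Set E3}

/-- **IN bound for the boundary functional, pointwise, from below.** At the configuration `S`, a
phase `v` with cluster `T = rootCell L v ∩ S` (`L > 0`): the fraction of points `y ∈ T` that are NOT
`r`-deep in `T` (`¬ S ∩ B̄(y, r) ⊆ T`) is at most the cell average `(1/#T) ∑_{y ∈ T} 1[v - L⁻¹ y ∉ deep_r]`
(contrapositive of `closedBall_subset_rootCell_of_deep`). [folklore] -/
theorem card_notDeep_div_le (hL : 0 < L) {T : Finset E3} {v : E3} (hT : (↑T : Set E3) = rootCell L v ∩ S) :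
    (Nat.card {y : T // ¬ (S ∩ Metric.closedBall (y : E3) r ⊆ ↑T)} : ℝ≥0∞) / T.card ≤
    (∑ y ∈ T, ({v : E3 | ∀ i, ((⌊-v i⌋ : ℤ) : ℝ) ≤ -r / L - v i ∧ r / L - v i < ⌊-v i⌋ + 1}ᶜ).indicator
        (1 : E3 → ℝ≥0∞) (v - L⁻¹ • y)) / T.card := by
  -- adapted from ThreeConeCertificateSlackRigidityLawBad (`cellAvg_bad_le`)
  classical
  gcongr
  rw [← sum_boole_eq_natCard T (fun y => ¬ (S ∩ Metric.closedBall y r ⊆ ↑T))]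
  refine Finset.sum_le_sum fun y hy => ?_
  have hyS : y ∈ rootCell L v ∩ S := by rw [← hT]; exact hy
  by_cases hb : ¬ (S ∩ Metric.closedBall y r ⊆ ↑T)
  · have hv : (v - L⁻¹ • y) ∈ ({v : E3 | ∀ i, ((⌊-v i⌋ : ℤ) : ℝ) ≤ -r / L - v i ∧
        r / L - v i < ⌊-v i⌋ + 1}ᶜ) := by
      intro hv
      refine hb fun z hz => ?_
      have hz' : z - y ∈ Metric.closedBall (0 : E3) r := by
        rw [Metric.mem_closedBall, dist_zero_right, ← dist_eq_norm]; exact hz.2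
      have h := closedBall_subset_rootCell_of_deep hL hv hz'
      have h' : z ∈ (fun w => w - y) ⁻¹' rootCell L (v - L⁻¹ • y) := h
      rw [preimage_sub_rootCell hL.ne' hyS.1] at h'
      rw [hT]; exact ⟨h', hz.1⟩
    rw [if_pos hb, Set.indicator_of_mem hv]
    simp
  · rw [if_neg hb]; exact bot_le

/-- **OUT for the boundary functional → 0**: the non-deep phases of `[0,1)³` have vanishing volume as
`L = n + 1 → ∞` (complement of `tendsto_volume_deep`). [folklore] -/
theorem tendsto_volume_nondeep (r : ℝ) :
    Tendsto (fun n : ℕ => volume (({v : E3 | ∀ i, ((⌊-v i⌋ : ℤ) : ℝ) ≤ -r / ((n : ℝ) + 1) - v i ∧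
      r / ((n : ℝ) + 1) - v i < ⌊-v i⌋ + 1}ᶜ) ∩ phaseDom)) atTop (𝓝 0) := by
  have hVt := volume_phaseDom_ne_top
  have h := ENNReal.Tendsto.sub (tendsto_const_nhds : Tendsto (fun _ : ℕ => volume phaseDom) atTop
    (𝓝 (volume phaseDom))) (tendsto_volume_deep r) (Or.inl hVt)
  rw [tsub_self] at h
  refine h.congr fun n => ?_
  rw [Set.inter_comm _ phaseDom, ← Set.sdiff_eq, ← measure_inter_add_sdiff phaseDom (measurableSet_deep _ r),
    ENNReal.add_sub_cancel_left (ne_top_of_le_ne_top hVt (measure_mono Set.inter_subset_left))]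

/-- The mixed functional `(μ, v) ↦ a₁ ofReal (locEnergy δ μ (rootCell L v) + C_δ) + a₂ 1[v ∉ deep_r]`
is jointly measurable. [folklore] -/
theorem measurable_mixedFunctional (δ L r : ℝ) (a₁ a₂ : ℝ≥0∞) :
    Measurable (Function.uncurry fun (μ : Measure E3) (v : E3) =>
      a₁ * ENNReal.ofReal (locEnergy δ μ (rootCell L v) + cst δ) +
        a₂ * ({v : E3 | ∀ i, ((⌊-v i⌋ : ℤ) : ℝ) ≤ -r / L - v i ∧ r / L - v i < ⌊-v i⌋ + 1}ᶜ).indicator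
          (1 : E3 → ℝ≥0∞) v) :=
  ((measurable_energyFunctional δ L).const_mul a₁).add
    (((measurable_one.indicator (measurableSet_deep L r).compl).comp measurable_snd).const_mul a₂)

/-- The mixed functional is `ℤ³`-periodic in the phase. [folklore] -/
theorem mixedFunctional_periodic (δ L r : ℝ) (a₁ a₂ : ℝ≥0∞) :
    ∀ (μ : Measure E3) (k v : E3), (∀ i, ∃ m : ℤ, k i = m) →
      a₁ * ENNReal.ofReal (locEnergy δ μ (rootCell L (k + v)) + cst δ) +
        a₂ * ({v : E3 | ∀ i, ((⌊-v i⌋ : ℤ) : ℝ) ≤ -r / L - v i ∧ r / L - v i < ⌊-v i⌋ + 1}ᶜ).indicator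
          (1 : E3 → ℝ≥0∞) (k + v) =
      a₁ * ENNReal.ofReal (locEnergy δ μ (rootCell L v) + cst δ) +
        a₂ * ({v : E3 | ∀ i, ((⌊-v i⌋ : ℤ) : ℝ) ≤ -r / L - v i ∧ r / L - v i < ⌊-v i⌋ + 1}ᶜ).indicator
          (1 : E3 → ℝ≥0∞) v := by
  intro μ k v hk
  rw [rootCell_int_add hk]
  congr 2
  by_cases hv : v ∈ {v : E3 | ∀ i, ((⌊-v i⌋ : ℤ) : ℝ) ≤ -r / L - v i ∧ r / L - v i < ⌊-v i⌋ + 1}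
  · rw [Set.indicator_of_notMem (fun h : _ ∈ _ᶜ => h ((deep_int_add_iff hk v).2 hv)),
      Set.indicator_of_notMem (fun h : _ ∈ _ᶜ => h hv)]
  · rw [Set.indicator_of_mem (show k + v ∈ _ᶜ from fun h => hv ((deep_int_add_iff hk v).1 h)),
      Set.indicator_of_mem (show v ∈ _ᶜ from hv)]
    rfl

/-- `x/2 + e < x/4 + x/8 + x/8 + e` is impossible in `ℝ≥0∞` for finite `x, e`. [folklore] -/
theorem not_half_add_lt {x e : ℝ≥0∞} (hx : x ≠ ∞) (he : e ≠ ∞) :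
    ¬ x / 2 + e < x / 4 + x / 8 + x / 8 + e := by
  -- adapted from ThreeConeCertificateSlackRigidityLawSelection (`not_half_lt`)
  intro h
  have h2 : x / 2 ≠ ∞ := ENNReal.div_ne_top hx (by norm_num)
  have h4 : x / 4 ≠ ∞ := ENNReal.div_ne_top hx (by norm_num)
  have h8 : x / 8 ≠ ∞ := ENNReal.div_ne_top hx (by norm_num)
  have h48 : x / 4 + x / 8 ≠ ∞ := ENNReal.add_ne_top.2 ⟨h4, h8⟩
  have h488 : x / 4 + x / 8 + x / 8 ≠ ∞ := ENNReal.add_ne_top.2 ⟨h48, h8⟩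
  have h' := (ENNReal.toReal_lt_toReal (ENNReal.add_ne_top.2 ⟨h2, he⟩)
    (ENNReal.add_ne_top.2 ⟨h488, he⟩)).2 h
  rw [ENNReal.toReal_add h2 he, ENNReal.toReal_add h488 he, ENNReal.toReal_add h48 h8,
    ENNReal.toReal_add h4 h8, ENNReal.toReal_div, ENNReal.toReal_div, ENNReal.toReal_div] at h'
  norm_num at h'
  have hx0 : 0 ≤ x.toReal := ENNReal.toReal_nonneg
  linarith

/-- **The absurd inequality** of the extended engine:
`β D + t c V ≤ b' V + (t (V c + A) + B)` is impossible when `V/2 < D`, `b' = β/4`, `t A ≤ β V/8`,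
`B ≤ β V/8`, everything finite and `β ≠ 0`. [folklore] -/
theorem absurd_of_ineq₃ {β V D t c A B b' : ℝ≥0∞} (hβ0 : β ≠ 0) (hβt : β ≠ ∞) (hVt : V ≠ ∞)
    (htc : t * c * V ≠ ∞) (hD : V / 2 < D) (hb' : b' = β / 4) (hA : t * A ≤ β * V / 8)
    (hB : B ≤ β * V / 8) (h : β * D + t * c * V ≤ b' * V + (t * (V * c + A) + B)) : False := by
  -- adapted from ThreeConeCertificateSlackRigidityLawSelection (`absurd_of_ineq`)
  have hbV : b' * V = β * V / 4 := by
    rw [hb', ENNReal.div_eq_inv_mul, ENNReal.div_eq_inv_mul, mul_assoc]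
  have h1 : β * D + t * c * V ≤ β * V / 4 + β * V / 8 + β * V / 8 + t * c * V :=
    calc _ ≤ b' * V + (t * (V * c + A) + B) := h
      _ = b' * V + t * A + B + t * c * V := by rw [mul_add]; ring
      _ ≤ β * V / 4 + β * V / 8 + β * V / 8 + t * c * V :=
          add_le_add (add_le_add (add_le_add hbV.le hA) hB) le_rfl
  have hlt : β * (V / 2) < β * D := by
    rw [mul_comm β (V / 2), mul_comm β D]
    exact ENNReal.mul_lt_mul_left hβ0 hβt hD
  refine not_half_add_lt (ENNReal.mul_ne_top hβt hVt) htc ?_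
  calc β * V / 2 + t * c * V = β * (V / 2) + t * c * V := by rw [mul_div_assoc]
    _ < β * D + t * c * V := ENNReal.add_lt_add_right htc hlt
    _ ≤ _ := h1

/-- **Pointwise selection inequality (three functionals).** If at mesh `L` no rooted `δ`-separated
sample `S ∋ 0`, phase `v` and cube cluster `T = rootCell L v ∩ S` has size `≥ M`, energy
`≤ #T e* + η #T`, deep-bad count `≥ b #T` AND not-`r`-deep count `≤ κ #T`, then at every rooted
`δ`-hard-core configuration and every phase
`cellAvg f_B + c/τ ≤ ofReal b + cellAvg (f_E/τ + f_∂/κ)`, `c = ofReal (e* + C_δ)`, `τ = min η τ_M`.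
[folklore] -/
theorem pointwise_bound (hδ : 0 < δ) (hL : 0 < L) {M : ℕ} {η b τ κ : ℝ} (hτ : 0 < τ) (hκ : 0 < κ)
    (hτη : τ ≤ η) (hsize : ∀ n : ℕ, 0 < n → n ≤ M → τ < groundStateEnergy lennardJones 3 n / n - eStar)
    (hc : -cst δ ≤ eStar)
    (hnone : ∀ (S : Set E3) (T : Finset E3) (v : E3), (∀ x ∈ S, ∀ y ∈ S, x ≠ y → δ ≤ dist x y) →
      (0 : E3) ∈ S → (↑T : Set E3) = rootCell L v ∩ S → M ≤ T.card →
      interactionEnergy lennardJones (fun i : Fin T.card => ((T.equivFin.symm i : T) : E3)) ≤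
        (T.card : ℝ) * eStar + η * T.card →
      (Nat.card {y : T // S ∩ Metric.closedBall (y : E3) R ⊆ ↑T ∧
          ((Measure.count : Measure E3).restrict S).map (fun z => z - (y : E3)) ∉ G} : ℝ) < b * T.card ∨
        κ * T.card < (Nat.card {y : T // ¬ (S ∩ Metric.closedBall (y : E3) r ⊆ ↑T)} : ℝ))
    {μ : Measure E3} (hμ : IsRootedHardCore δ μ) (v : E3) :
    (∫⁻ y in rootCell L v, Gᶜ.indicator (1 : Measure E3 → ℝ≥0∞) (μ.map fun z => z - y) *
        {v : E3 | ∀ i, ((⌊-v i⌋ : ℤ) : ℝ) ≤ -R / L - v i ∧ R / L - v i < ⌊-v i⌋ + 1}.indicator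
          (1 : E3 → ℝ≥0∞) (v - L⁻¹ • y) ∂μ) / μ (rootCell L v) +
      (ENNReal.ofReal τ)⁻¹ * ENNReal.ofReal (eStar + cst δ) ≤
    ENNReal.ofReal b + (∫⁻ y in rootCell L v, ((ENNReal.ofReal τ)⁻¹ *
        ENNReal.ofReal (locEnergy δ (μ.map fun z => z - y) (rootCell L (v - L⁻¹ • y)) + cst δ) +
        (ENNReal.ofReal κ)⁻¹ * ({v : E3 | ∀ i, ((⌊-v i⌋ : ℤ) : ℝ) ≤ -r / L - v i ∧
          r / L - v i < ⌊-v i⌋ + 1}ᶜ).indicator (1 : E3 → ℝ≥0∞) (v - L⁻¹ • y)) ∂μ) / μ (rootCell L v) := by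
  -- adapted from ThreeConeCertificateSlackRigidityLawSelection (`pointwise_bound`)
  obtain ⟨S, h0, hsep, rfl⟩ := hμ
  obtain ⟨T, hT, h0T⟩ := exists_cluster hδ hL h0 hsep v
  have hB := cellAvg_deepBad_le (R := R) (G := G) hL hT
  have hEq := cellAvg_energy_eq hδ hL h0 hsep hT
  have hbd := card_notDeep_div_le (r := r) hL hT
  have hcard : 0 < T.card := Finset.card_pos.2 ⟨0, h0T⟩
  have hcr : (0 : ℝ) < T.card := by exact_mod_cast hcard
  have hc0T : (T.card : ℝ≥0∞) ≠ 0 := by exact_mod_cast hcard.ne'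
  set E : ℝ := interactionEnergy lennardJones (fun i : Fin T.card => ((T.equivFin.symm i : T) : E3)) with hEdef
  set Y : ℝ := E / T.card - eStar with hYdef
  have hY : 0 ≤ Y := excess_per_particle_nonneg hcard
  have hc0 : 0 ≤ eStar + cst δ := by linarith
  have hsplit : ENNReal.ofReal (E / T.card + cst δ) = ENNReal.ofReal Y + ENNReal.ofReal (eStar + cst δ) := by
    rw [← ENNReal.ofReal_add hY hc0]
    congr 1
    rw [hYdef]; ring
  rw [setLIntegral_rootCell_eq_sum hT, count_restrict_rootCell_eq_card hT, hsplit] at hEq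
  set q : ℝ≥0∞ := (Nat.card {y : T // S ∩ Metric.closedBall (y : E3) R ⊆ ↑T ∧
    ((Measure.count : Measure E3).restrict S).map (fun z => z - (y : E3)) ∉ G} : ℝ≥0∞) / T.card
    with hqdef
  set p : ℝ≥0∞ := (Nat.card {y : T // ¬ (S ∩ Metric.closedBall (y : E3) r ⊆ ↑T)} : ℝ≥0∞) / T.card
    with hpdef
  have hτ0 : ENNReal.ofReal τ ≠ 0 := (ENNReal.ofReal_pos.2 hτ).ne'
  have hκ0 : ENNReal.ofReal κ ≠ 0 := (ENNReal.ofReal_pos.2 hκ).ne'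
  -- reduce to sums over the cluster
  refine (add_le_add hB le_rfl).trans ?_
  rw [setLIntegral_rootCell_eq_sum hT, count_restrict_rootCell_eq_card hT, Finset.sum_add_distrib,
    ← Finset.mul_sum, ← Finset.mul_sum, ENNReal.add_div, mul_div_assoc, mul_div_assoc, hEq]
  have hq1 : q ≤ 1 := by
    rw [hqdef, ENNReal.div_le_iff_le_mul (Or.inl hc0T) (Or.inl (ENNReal.natCast_ne_top _)), one_mul]
    exact_mod_cast (Nat.card_le_card_of_injective _ Subtype.val_injective).trans_eq (Nat.card_eq_finsetCard T)
  -- the case analysis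
  have key : q ≤ ENNReal.ofReal b ∨ τ < Y ∨ ENNReal.ofReal κ ≤ p := by
    by_cases hM : M ≤ T.card
    · by_cases hEn : E ≤ (T.card : ℝ) * eStar + η * T.card
      · rcases hnone S T v hsep h0 hT hM hEn with hlt | hlt
        · left
          have h := ENNReal.ofReal_le_ofReal ((div_lt_iff₀ hcr).2 hlt).le
          rwa [ENNReal.ofReal_div_of_pos hcr, ENNReal.ofReal_natCast, ENNReal.ofReal_natCast] at h
        · right; right
          have h := ENNReal.ofReal_le_ofReal ((lt_div_iff₀ hcr).2 hlt).le
          rwa [ENNReal.ofReal_div_of_pos hcr, ENNReal.ofReal_natCast, ENNReal.ofReal_natCast] at h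
      · right; left
        push Not at hEn
        have : eStar + η < E / T.card := by
          rw [lt_div_iff₀ hcr]; linarith
        linarith
    · right; left
      push Not at hM
      have hs := hsize T.card hcard hM.le
      have hge : groundStateEnergy lennardJones 3 T.card ≤ E :=
        Literature.MathematicalPhysics.StatisticalMechanics.groundStateEnergy_lennardJones_le (injective_enum T)
      have : groundStateEnergy lennardJones 3 T.card / T.card ≤ E / T.card :=
        div_le_div_of_nonneg_right hge hcr.le
      linarith
  rcases key with hq | hYτ | hκp
  · exact add_le_add hq (le_add_right (mul_le_mul_right le_add_self _))
  · have h1 : (1 : ℝ≥0∞) ≤ (ENNReal.ofReal τ)⁻¹ * ENNReal.ofReal Y := by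
      rw [← ENNReal.inv_mul_cancel hτ0 ENNReal.ofReal_ne_top]
      exact mul_le_mul_right (ENNReal.ofReal_le_ofReal hYτ.le) _
    calc q + (ENNReal.ofReal τ)⁻¹ * ENNReal.ofReal (eStar + cst δ)
        ≤ (ENNReal.ofReal τ)⁻¹ * ENNReal.ofReal Y + (ENNReal.ofReal τ)⁻¹ * ENNReal.ofReal (eStar + cst δ) :=
          add_le_add (hq1.trans h1) le_rfl
      _ = (ENNReal.ofReal τ)⁻¹ * (ENNReal.ofReal Y + ENNReal.ofReal (eStar + cst δ)) := (mul_add _ _ _).symm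
      _ ≤ _ := le_add_left le_self_add
  · have h1 : (1 : ℝ≥0∞) ≤ (ENNReal.ofReal κ)⁻¹ * p := by
      rw [← ENNReal.inv_mul_cancel hκ0 ENNReal.ofReal_ne_top]
      exact mul_le_mul_right hκp _
    calc q + (ENNReal.ofReal τ)⁻¹ * ENNReal.ofReal (eStar + cst δ)
        ≤ (ENNReal.ofReal κ)⁻¹ * p + (ENNReal.ofReal τ)⁻¹ * ENNReal.ofReal (eStar + cst δ) :=
          add_le_add (hq1.trans h1) le_rfl
      _ ≤ _ := le_add_left (by
          rw [add_comm ((ENNReal.ofReal κ)⁻¹ * p)]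
          exact add_le_add (mul_le_mul_right le_add_self _) (mul_le_mul_right hbd _))

/-- **Selection of a deep-bad cube cluster with few boundary points.** For a point-stationary
probability law `P`, a.s. rooted `δ`-hard-core, with `E_P[h] ≤ e*`, and a measurable event `G` with
`P(Gᶜ) ≠ 0`, there is `b > 0` such that for all `R, r`, `κ > 0`, `η > 0`, `M` some rooted
`δ`-separated sample `S ∋ 0`, mesh `L ≥ M`, phase `v` and cube cluster `T = S ∩ rootCell L v` have
`#T ≥ M`, `𝓔(T) ≤ #T e* + η #T`, at least `b #T` points `y` with `S ∩ B̄(y, R) ⊆ T` and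
`θ_y (count|S) ∉ G`, and at most `κ #T` points `y` with `¬ S ∩ B̄(y, r) ⊆ T`. [folklore] -/
theorem exists_deepBadCluster_bdry (hδ : 0 < δ) (P : Measure (Measure E3)) [IsProbabilityMeasure P]
    (hcore : ∀ᵐ μ ∂P, IsRootedHardCore δ μ) (hstat : IsPointStationaryLaw P)
    (hE : (∫ μ, rootEnergy lennardJones μ ∂P) ≤ eStar) (hGm : MeasurableSet G) (hbad : P Gᶜ ≠ 0) :
    ∃ b : ℝ, 0 < b ∧ ∀ (R r κ η : ℝ) (M : ℕ), 0 < κ → 0 < η →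
      ∃ (S : Set E3) (T : Finset E3) (L : ℝ) (v : E3), (∀ x ∈ S, ∀ y ∈ S, x ≠ y → δ ≤ dist x y) ∧
        (0 : E3) ∈ S ∧ (M : ℝ) ≤ L ∧ (↑T : Set E3) = S ∩ rootCell L v ∧ M ≤ T.card ∧
        interactionEnergy lennardJones (fun i : Fin T.card => ((T.equivFin.symm i : T) : E3)) ≤
          (T.card : ℝ) * eStar + η * T.card ∧
        b * T.card ≤ (Nat.card {y : T // S ∩ Metric.closedBall (y : E3) R ⊆ ↑T ∧
          ((Measure.count : Measure E3).restrict S).map (fun z => z - (y : E3)) ∉ G} : ℝ) ∧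
        (Nat.card {y : T // ¬ (S ∩ Metric.closedBall (y : E3) r ⊆ ↑T)} : ℝ) ≤ κ * T.card := by
  -- adapted from ThreeConeCertificateSlackRigidityLawSelection (`exists_badCluster`)
  set β : ℝ≥0∞ := P Gᶜ with hβdef
  have hβt : β ≠ ∞ := measure_ne_top P _
  have hβpos : 0 < β.toReal := ENNReal.toReal_pos hbad hβt
  refine ⟨β.toReal / 4, by positivity, fun R r κ η M hκ hη => ?_⟩
  by_contra hcon
  -- thresholds
  obtain ⟨τ₁, hτ₁, hsize₁⟩ := exists_pos_lt_excessRate M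
  set τ : ℝ := min η τ₁ with hτdef
  have hτ : 0 < τ := lt_min hη hτ₁
  have hτη : τ ≤ η := min_le_left _ _
  have hsize : ∀ n : ℕ, 0 < n → n ≤ M → τ < groundStateEnergy lennardJones 3 n / n - eStar :=
    fun n hn hM => (min_le_right _ _).trans_lt (hsize₁ n hn hM)
  have hc : -cst δ ≤ eStar := neg_cst_le_eStar hδ P hcore hE
  set V : ℝ≥0∞ := volume phaseDom with hVdef
  have hV0 : V ≠ 0 := volume_phaseDom_ne_zero
  have hVt : V ≠ ∞ := volume_phaseDom_ne_top
  have hK0 : β * V / 8 ≠ 0 := (ENNReal.div_pos_iff.2 ⟨mul_ne_zero hbad hV0, by norm_num⟩).ne'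
  have hτ0 : ENNReal.ofReal τ ≠ 0 := (ENNReal.ofReal_pos.2 hτ).ne'
  have hκ0 : ENNReal.ofReal κ ≠ 0 := (ENNReal.ofReal_pos.2 hκ).ne'
  have hτit : (ENNReal.ofReal τ)⁻¹ ≠ ∞ := ENNReal.inv_ne_top.2 hτ0
  have hκit : (ENNReal.ofReal κ)⁻¹ ≠ ∞ := ENNReal.inv_ne_top.2 hκ0
  -- choose the mesh
  have hev1 : ∀ᶠ n : ℕ in atTop, V / 2 < volume (phaseDom ∩ {v : E3 | ∀ i,
      ((⌊-v i⌋ : ℤ) : ℝ) ≤ -R / ((n : ℝ) + 1) - v i ∧ R / ((n : ℝ) + 1) - v i < ⌊-v i⌋ + 1}) :=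
    (tendsto_volume_deep R).eventually (Ioi_mem_nhds (ENNReal.half_lt_self hV0 hVt))
  have hev2 : ∀ᶠ n : ℕ in atTop, ENNReal.ofReal (1 / 12) * ∫⁻ μ, errTerm ((n : ℝ) + 1) μ ∂P <
      ENNReal.ofReal τ * (β * V / 8) := by
    have h := ENNReal.Tendsto.const_mul (tendsto_lintegral_errTerm hδ P hcore) (Or.inr ENNReal.ofReal_ne_top)
      (a := ENNReal.ofReal (1 / 12))
    rw [mul_zero] at h
    exact h.eventually (Iio_mem_nhds (pos_iff_ne_zero.2 (mul_ne_zero hτ0 hK0)))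
  have hev3 : ∀ᶠ n : ℕ in atTop, volume (({v : E3 | ∀ i, ((⌊-v i⌋ : ℤ) : ℝ) ≤ -r / ((n : ℝ) + 1) - v i ∧
      r / ((n : ℝ) + 1) - v i < ⌊-v i⌋ + 1}ᶜ) ∩ phaseDom) < ENNReal.ofReal κ * (β * V / 8) :=
    (tendsto_volume_nondeep r).eventually (Iio_mem_nhds (pos_iff_ne_zero.2 (mul_ne_zero hκ0 hK0)))
  have hev4 : ∀ᶠ n : ℕ in atTop, (M : ℝ) ≤ (n : ℝ) + 1 :=
    (eventually_ge_atTop M).mono fun n hn => (Nat.cast_le.2 hn).trans (le_add_of_nonneg_right zero_le_one)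
  obtain ⟨n, ⟨⟨hn1, hn2⟩, hn3⟩, hn4⟩ := (((hev1.and hev2).and hev3).and hev4).exists
  set L : ℝ := (n : ℝ) + 1 with hLdef
  have hL : 0 < L := by positivity
  -- no admissible cube cluster at mesh `L`
  have hnone : ∀ (S : Set E3) (T : Finset E3) (v : E3), (∀ x ∈ S, ∀ y ∈ S, x ≠ y → δ ≤ dist x y) →
      (0 : E3) ∈ S → (↑T : Set E3) = rootCell L v ∩ S → M ≤ T.card →
      interactionEnergy lennardJones (fun i : Fin T.card => ((T.equivFin.symm i : T) : E3)) ≤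
        (T.card : ℝ) * eStar + η * T.card →
      (Nat.card {y : T // S ∩ Metric.closedBall (y : E3) R ⊆ ↑T ∧
          ((Measure.count : Measure E3).restrict S).map (fun z => z - (y : E3)) ∉ G} : ℝ) <
          β.toReal / 4 * T.card ∨
        κ * T.card < (Nat.card {y : T // ¬ (S ∩ Metric.closedBall (y : E3) r ⊆ ↑T)} : ℝ) := by
    intro S T v hsep h0 hT hM hEn
    by_contra hno
    obtain ⟨h1, h2⟩ := not_or.1 hno
    exact hcon ⟨S, T, L, v, hsep, h0, hn4, by rw [hT, Set.inter_comm], hM, hEn, not_lt.1 h1, not_lt.1 h2⟩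
  -- the cell-averaging identities for `f_B`, `f_E` and `H = f_E/τ + f_∂/κ`
  have hBout := lintegral_badFunctional_eq hGm L R P
  have hBid := lintegral_phase_eq_cellAverage hδ hL (measurable_badFunctional hGm L R)
    (badFunctional_periodic G L R) hcore hstat
  have hEid := lintegral_phase_eq_cellAverage (P := P) hδ hL (measurable_energyFunctional δ L)
    (energyFunctional_periodic δ L) hcore hstat
  have hHid := lintegral_phase_eq_cellAverage (P := P) hδ hL
    (measurable_mixedFunctional δ L r (ENNReal.ofReal τ)⁻¹ (ENNReal.ofReal κ)⁻¹)
    (mixedFunctional_periodic δ L r _ _) hcore hstat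
  -- the energy bound `E[∫ f_E] ≤ V c + K`
  have hEle := lintegral_cellAvg_energy_le hδ hL P hcore hstat hE
  rw [← hEid] at hEle
  -- `E[∫ H] = τ⁻¹ E[∫ f_E] + κ⁻¹ vol(non-deep phases)`
  have hDc := (measurableSet_deep L r).compl
  have hHint : ∀ μ : Measure E3, ∫⁻ v in phaseDom, ((ENNReal.ofReal τ)⁻¹ *
      ENNReal.ofReal (locEnergy δ μ (rootCell L v) + cst δ) + (ENNReal.ofReal κ)⁻¹ *
      ({v : E3 | ∀ i, ((⌊-v i⌋ : ℤ) : ℝ) ≤ -r / L - v i ∧ r / L - v i < ⌊-v i⌋ + 1}ᶜ).indicator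
        (1 : E3 → ℝ≥0∞) v) =
      (ENNReal.ofReal τ)⁻¹ * (∫⁻ v in phaseDom, ENNReal.ofReal (locEnergy δ μ (rootCell L v) + cst δ)) +
        (ENNReal.ofReal κ)⁻¹ * volume (({v : E3 | ∀ i, ((⌊-v i⌋ : ℤ) : ℝ) ≤ -r / L - v i ∧
          r / L - v i < ⌊-v i⌋ + 1}ᶜ) ∩ phaseDom) := fun μ => by
    rw [lintegral_add_right _ ((measurable_one.indicator hDc).const_mul _), lintegral_const_mul' _ _ hτit,
      lintegral_const_mul' _ _ hκit, lintegral_indicator_one hDc, Measure.restrict_apply hDc]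
  simp_rw [hHint] at hHid
  rw [lintegral_add_right _ measurable_const, lintegral_const_mul' _ _ hτit, lintegral_const, measure_univ,
    mul_one] at hHid
  -- integrate the pointwise bound (inner and outer integral), insert the identities
  have hI := lintegral_mono_ae (hcore.mono fun μ hμ => lintegral_mono (μ := volume.restrict phaseDom)
    fun v => pointwise_bound (R := R) (r := r) (G := G) hδ hL hτ hκ hτη hsize hc hnone hμ v)
  simp only [lintegral_add_right _ measurable_const, lintegral_add_left measurable_const,
    lintegral_const, Measure.restrict_apply_univ, measure_univ, mul_one] at hI
  rw [← hBid, hBout, ← hHid] at hI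
  have hI2 := hI.trans (add_le_add le_rfl (add_le_add (mul_le_mul_right hEle _) le_rfl))
  -- the absurd inequality
  have hb4 : ENNReal.ofReal (β.toReal / 4) = β / 4 := by
    rw [ENNReal.ofReal_div_of_pos (by norm_num : (0 : ℝ) < 4), ENNReal.ofReal_toReal hβt,
      ENNReal.ofReal_ofNat]
  refine absurd_of_ineq₃ hbad hβt hVt (ENNReal.mul_ne_top (ENNReal.mul_ne_top hτit ENNReal.ofReal_ne_top) hVt)
    hn1 hb4 ?_ ?_ hI2
  · calc (ENNReal.ofReal τ)⁻¹ * (ENNReal.ofReal (1 / 12) * ∫⁻ μ, errTerm L μ ∂P)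
        ≤ (ENNReal.ofReal τ)⁻¹ * (ENNReal.ofReal τ * (β * V / 8)) := mul_le_mul_right hn2.le _
      _ = β * V / 8 := by rw [← mul_assoc, ENNReal.inv_mul_cancel hτ0 ENNReal.ofReal_ne_top, one_mul]
  · calc (ENNReal.ofReal κ)⁻¹ * volume (({v : E3 | ∀ i, ((⌊-v i⌋ : ℤ) : ℝ) ≤ -r / L - v i ∧
          r / L - v i < ⌊-v i⌋ + 1}ᶜ) ∩ phaseDom)
        ≤ (ENNReal.ofReal κ)⁻¹ * (ENNReal.ofReal κ * (β * V / 8)) := mul_le_mul_right hn3.le _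
      _ = β * V / 8 := by rw [← mul_assoc, ENNReal.inv_mul_cancel hκ0 ENNReal.ofReal_ne_top, one_mul]

/-- **Registered stub `stub_clusterSelectionBdry`** (crux stmt-AtomisticToContinuum-11960, line
`priced-floors-palm-exactification`): the extended cluster-selection engine (exported root, mesh and
cube; boundary-fraction control) for a minimising point-stationary hard-core law and an arbitrary
measurable event of positive failure probability. [folklore] -/
theorem stub_clusterSelectionBdry : ∀ δ : ℝ, 0 < δ → ∀ P : Measure (Measure E3), IsProbabilityMeasure P → IsMinimisingLaw δ P → ∀ G : Set (Measure E3), MeasurableSet G → P Gᶜ ≠ 0 → ∃ b : ℝ, 0 < b ∧ ∀ (R r κ η : ℝ) (M : ℕ), 0 < κ → 0 < η → ∃ (S : Set E3) (T : Finset E3) (L : ℝ) (v : E3), (∀ x ∈ S, ∀ y ∈ S, x ≠ y → δ ≤ dist x y) ∧ (0 : E3) ∈ S ∧ (M : ℝ) ≤ L ∧ (↑T : Set E3) = S ∩ rootCell L v ∧ M ≤ T.card ∧ interactionEnergy lennardJones (fun i : Fin T.card => ((T.equivFin.symm i : T) : E3)) ≤ (T.card : ℝ) * eStar + η * T.card ∧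 b * T.card ≤ (Nat.card {y : T // S ∩ Metric.closedBall (y : E3) R ⊆ ↑T ∧ ((Measure.count : Measure E3).restrict S).map (fun z => z - (y : E3)) ∉ G} : ℝ) ∧ (Nat.card {y : T // ¬ (S ∩ Metric.closedBall (y : E3) r ⊆ ↑T)} : ℝ) ≤ κ * T.card := by
  intro δ hδ P hP hlaw G hGm hbad
  haveI := hP
  obtain ⟨hcore, hstat, hE⟩ := hlaw
  exact exists_deepBadCluster_bdry hδ P hcore hstat hE hGm hbad

end Summit.AtomisticToContinuum.Crystallization.Theorems.SlackRigidityPricedFloorsSelectionBdry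

end
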